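import Literature.IUT.HodgeTheaters.PiAvatarEvalSections

/-!
# What a model must supply for `label_rigid`: the image criterion for Example 4.4's label rigidity
# (abc-iut-L5-t3 gen 7 — author's note on `EvalSectionBinder` for row «EVALSECT-NV»; PROOF-ONLY companion of
# `PiAvatarEvalSections.lean` (p456598, frozen): 0 defs, 0 instances, nothing restated)

S. Mochizuki, *Inter-universal Teichmüller theory I*, kurims manuscript (May 2020), Ex 4.4 (i) p.106 (evaluation sections and their labels,
«a group-theoretic algorithm for constructing the evaluation sections»), (ii) p.106–107 (the classes `φ^Θ_{v̲_j}`, «composing with arbitrary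
isomorphisms»), (iv) p.107 / Rmk 4.2.1 p.98 (labels well defined up to `{±1}`). [claim: Mochizuki2012, status: disputed]

For an `EvalSections` binder `ES` at a bad place write `Im_j := s_j(aug(Π_v̲)) ≤ Π_{C_F}` for the AMBIENT image of `φ^Θ_{v̲_j} = s_j ∘ aug|_{Π_v̲}`,
i.e. the subgroup `((ES.evalHom j).range).map Π_v̲.subtype` (in print: the decomposition group of the evaluation point).  PROVED here:
* `map_range_eq_conj_of_mem_thetaClass` — every representative of every member of the class `thetaClass j` (two-sided composites
  `[c_n] ≫ [s_j ∘ aug] ≫ [c_m]`, `n, m ∈ N_{Π_{C_F}}(Π_v̲)`, modulo inner automorphisms of `Π_v̲`) has ambient image an `N(Π_v̲)`-CONJUGATE of `Im_j`;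
* **`labelRigid_iff_range_not_conj`** — CHARACTERISATION: `ES.LabelRigid` ⟺ (`Im_{j′} = n·Im_j·n⁻¹` with `n ∈ N(Π_v̲)` forces `j = j′`), i.e. label
  rigidity of the classes IS pairwise non-conjugacy of the `|𝔽_l|` images under `N_{Π_{C_F}}(Π_v̲)` — no more and no less (sufficiency
  `labelRigid_of_range_not_conj`; necessity via `evalHom_eq_conj_of_range_eq_conj`: conjugate images force `φ^Θ_{v̲_{j′}} = c_n ≫ φ^Θ_{v̲_j} ≫ c_{n⁻¹}`
  ON THE NOSE, `aug` being injective on a section image); `labelRigid_of_invariant` — the printed shape: ANY invariant of subgroups of `Π_{C_F}` under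
  `N(Π_v̲)`-conjugation that separates the `Im_j` gives rigidity (print, p.106: «[EtTh], Corollary 2.9 [concerning the group-theoreticity of the
  labels]»; [SemiAnbd] Thm 6.8 (iii) — content after-merge, L2/L3);
* **`not_labelRigid_of_sect_conj`** — NECESSARY side / design warning: two sections with DISTINCT labels that are conjugate by an element of `Π_v̲`
  itself have EQUAL outer classes (`evalOuter_eq_of_sect_conj`), so `LabelRigid` FAILS — in a semidirect model `Π_v̲ = Δ ⋊ G` the torsion-translates
  `s_m = c_m ∘ s_0` by `m ∈ Δ ≤ Π_v̲` can never carry distinct labels; the translating elements must lie outside `Π_v̲` (indeed outside every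
  `N(Π_v̲)`-coset meeting the normaliser of `Im_0`).
No new Prop fact, no def, no instance; typed ≠ inhabited; a binder is an assumption label; nothing here takes a side on [IUTchIII] Cor. 3.12.
-/

namespace Literature.IUT.HodgeTheaters

open CategoryTheory
open scoped Pointwise

universe u v w

/-! ### §1 Ambient images of homomorphisms between subgroups, and their conjugates -/

namespace OuterHom

variable {A : Type u} [Group A] {H H' H'' : Subgroup A}

/-- Membership in a conjugate subgroup `n S n⁻¹ = MulAut.conj n • S`. ([IUTchI] §0 p.33) [claim: Mochizuki2012, status: disputed] -/
theorem mem_conj_smul_iff {n : A} {S : Subgroup A} {y : A} : y ∈ MulAut.conj n • S ↔ n⁻¹ * y * n ∈ S := by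
  rw [Subgroup.mem_pointwise_smul_iff_inv_smul_mem, ← map_inv, MulAut.smul_def, MulAut.conj_apply, inv_inv]

/-- `(n n′) S (n n′)⁻¹ = n (n′ S n′⁻¹) n⁻¹`. ([IUTchI] §0 p.33) [claim: Mochizuki2012, status: disputed] -/
theorem conj_mul_smul (n n' : A) (S : Subgroup A) : MulAut.conj (n * n') • S = MulAut.conj n • MulAut.conj n' • S := by
  rw [map_mul, mul_smul]

/-- `(n⁻¹ n) S (n⁻¹ n)⁻¹ = S`. ([IUTchI] §0 p.33) [claim: Mochizuki2012, status: disputed] -/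
theorem conj_inv_mul_smul (n : A) (S : Subgroup A) : MulAut.conj n⁻¹ • MulAut.conj n • S = S := by
  rw [← conj_mul_smul, inv_mul_cancel, map_one, one_smul]

/-- Membership in the AMBIENT image `φ(H) ≤ A` of `φ : H → H′`. ([IUTchI] §0 p.33) [claim: Mochizuki2012, status: disputed] -/
theorem mem_map_range_iff {φ : H →* H'} {y : A} : y ∈ φ.range.map H'.subtype ↔ ∃ x : H, ((φ x : H') : A) = y := by
  constructor
  · rintro ⟨z, ⟨x, rfl⟩, rfl⟩
    exact ⟨x, rfl⟩
  · rintro ⟨x, hx⟩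
    exact ⟨φ x, ⟨x, rfl⟩, hx⟩

/-- Precomposing with a SURJECTION does not change the ambient image. ([IUTchI] §0 p.33) [claim: Mochizuki2012, status: disputed] -/
theorem map_range_comp_of_surjective (φ : H →* H') (σ : H'' →* H) (hσ : Function.Surjective σ) :
    (φ.comp σ).range.map H'.subtype = φ.range.map H'.subtype := by
  ext y
  simp only [mem_map_range_iff, MonoidHom.comp_apply]
  constructor
  · rintro ⟨x, hx⟩
    exact ⟨σ x, hx⟩
  · rintro ⟨x, hx⟩
    obtain ⟨x₀, rfl⟩ := hσ x
    exact ⟨x₀, hx⟩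

/-- Postcomposing with `x ↦ m⁻¹ x m` conjugates the ambient image by `m⁻¹`. ([IUTchI] §0 p.33) [claim: Mochizuki2012, status: disputed] -/
theorem map_range_conjHom_comp (φ : H →* H') (m : A) (hm : ∀ x ∈ H', m⁻¹ * x * m ∈ H'') :
    ((conjHom m hm).comp φ).range.map H''.subtype = MulAut.conj m⁻¹ • φ.range.map H'.subtype := by
  ext y
  simp only [mem_map_range_iff, mem_conj_smul_iff, MonoidHom.comp_apply, coe_conjHom, inv_inv]
  constructor
  · rintro ⟨x, hx⟩
    exact ⟨x, by rw [← hx]; group⟩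
  · rintro ⟨x, hx⟩
    exact ⟨x, by rw [hx]; group⟩

/-- INNER-EQUIVALENT homomorphisms have ambient images conjugate by an element of the TARGET. ([IUTchI] §0 p.33)
[claim: Mochizuki2012, status: disputed] -/
theorem map_range_eq_conj_of_forall {φ ψ : H →* H'} (c : H') (h : ∀ x, ψ x = c * φ x * c⁻¹) :
    ψ.range.map H'.subtype = MulAut.conj (c : A) • φ.range.map H'.subtype := by
  ext y
  simp only [mem_map_range_iff, mem_conj_smul_iff]
  constructor
  · rintro ⟨x, hx⟩
    refine ⟨x, ?_⟩
    rw [← hx, h x, Subgroup.coe_mul, Subgroup.coe_mul, Subgroup.coe_inv]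
    group
  · rintro ⟨x, hx⟩
    refine ⟨x, ?_⟩
    rw [h x, Subgroup.coe_mul, Subgroup.coe_mul, Subgroup.coe_inv, hx]
    group

/-- For `n` in the normaliser of `H`, `x ↦ n⁻¹ x n : H → H` is SURJECTIVE. ([IUTchI] §0 p.33) [claim: Mochizuki2012, status: disputed] -/
theorem conjHom_surjective_of_mem_normalizer (n : A) (hn : n ∈ Subgroup.normalizer (H : Set A))
    (h : ∀ x ∈ H, n⁻¹ * x * n ∈ H) : Function.Surjective (conjHom (H' := H) n h) := by
  intro y
  have hy : n * (y : A) * n⁻¹ ∈ H := (Subgroup.mem_normalizer_iff.mp hn y).mp y.2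
  exact ⟨⟨n * y * n⁻¹, hy⟩, Subtype.ext (by simp only [coe_conjHom]; group)⟩

end OuterHom

/-! ### §2 The image criterion for `LabelRigid` -/

section Criterion

variable {F : Type u} {K : Type v} {Fbar : Type w} [Field F] [NumberField F] [Field K] [NumberField K]
  [Algebra F K] [Field Fbar] [Algebra F Fbar] [Algebra K Fbar]
  {E : WeierstrassCurve F} [E.IsElliptic] {l : ℕ} {Pb : BadPlacePredicates K}
  {D : InitialThetaData F K Fbar E l Pb} {CG : D.geom.pe.CuspGalois} {hS : D.CuspClassesNormaliserStable} [Fact l.Prime]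

namespace InitialThetaData

namespace EvalSections

variable {δ : D.LocalDatum CG hS} {Gv : Subgroup (Fbar ≃ₐ[F] Fbar)} (ES : EvalSections δ Gv)

/-- **`Im_j`**: `y ∈ Im_j` iff `y = s_j(aug x)` for some `x ∈ Π_v̲`. ([IUTchI] Ex 4.4 (i) p.106) [claim: Mochizuki2012, status: disputed] -/
theorem mem_map_range_evalHom_iff {j : FlAbs l} {y : D.PiC} :
    y ∈ (ES.evalHom j).range.map δ.H.subtype ↔ ∃ x : ↥δ.H, ES.sect j ⟨D.augGF x, ES.aug_mem x x.2⟩ = y := by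
  simp only [OuterHom.mem_map_range_iff, coe_evalHom]

/-- `Im_j ≤ Π_v̲`. ([IUTchI] Ex 4.4 (i) p.106) [claim: Mochizuki2012, status: disputed] -/
theorem map_range_evalHom_le (j : FlAbs l) : (ES.evalHom j).range.map δ.H.subtype ≤ δ.H := by
  intro y hy
  obtain ⟨x, rfl⟩ := OuterHom.mem_map_range_iff.mp hy
  exact (ES.evalHom j x).2

/-- **Images along a class**: every representative `φ` of every member of `thetaClass j` (`[c_n] ≫ [s_j ∘ aug] ≫ [c_m]`, `n, m ∈ N(Π_v̲)`, modulo inner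
automorphisms of `Π_v̲`) has ambient image `φ(Π_v̲) = n′ · Im_j · n′⁻¹` for some `n′ ∈ N_{Π_{C_F}}(Π_v̲)`. ([IUTchI] Ex 4.4 (ii) p.107)
[claim: Mochizuki2012, status: disputed] -/
theorem map_range_eq_conj_of_mem_thetaClass {j : FlAbs l} {f : OuterHom δ.H δ.H} (hf : f ∈ ES.thetaClass j)
    (φ : ↥δ.H →* ↥δ.H) (hφ : OuterHom.ofHom φ = f) :
    ∃ n ∈ Subgroup.normalizer ((δ.H : Subgroup D.PiC) : Set D.PiC),
      φ.range.map δ.H.subtype = MulAut.conj n • (ES.evalHom j).range.map δ.H.subtype := by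
  obtain ⟨n, m, hn, hm, rfl⟩ := hf
  have hrep : ((OuterHom.ofConj n (conj_mem_of_mem_normalizer hn)).comp (ES.evalOuter j)).comp
        (OuterHom.ofConj m (conj_mem_of_mem_normalizer hm))
      = OuterHom.ofHom ((OuterHom.conjHom m (conj_mem_of_mem_normalizer hm)).comp
          ((ES.evalHom j).comp (OuterHom.conjHom n (conj_mem_of_mem_normalizer hn)))) := rfl
  rw [hrep, OuterHom.ofHom_eq_ofHom_iff] at hφ
  obtain ⟨c, hc⟩ := hφ
  have h1 := OuterHom.map_range_eq_conj_of_forall c hc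
  rw [OuterHom.map_range_conjHom_comp, OuterHom.map_range_comp_of_surjective _ _
    (OuterHom.conjHom_surjective_of_mem_normalizer n hn _)] at h1
  -- `h1 : m⁻¹ · Im_j · m = c · φ(Π_v̲) · c⁻¹`
  refine ⟨(c : D.PiC)⁻¹ * m⁻¹, ?_, ?_⟩
  · exact Subgroup.mul_mem _ (Subgroup.inv_mem _ (Subgroup.le_normalizer c.2)) (Subgroup.inv_mem _ hm)
  · rw [OuterHom.conj_mul_smul, h1, OuterHom.conj_inv_mul_smul]

/-- **THE IMAGE CRITERION (sufficient condition for Example 4.4 (iv)'s label rigidity)**: if the ambient images of evaluation sections with DISTINCT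
labels are never conjugate under the normaliser `N_{Π_{C_F}}(Π_v̲)` («`Aut(𝒟_v̲)`»), then `LabelRigid` holds — what a (semidirect) model must supply for the
field `label_rigid` of `EvalSectionBinder`. ([IUTchI] Ex 4.4 (iv) p.107) [claim: Mochizuki2012, status: disputed] -/
theorem labelRigid_of_range_not_conj
    (h : ∀ (j j' : FlAbs l) (n : D.PiC), n ∈ Subgroup.normalizer ((δ.H : Subgroup D.PiC) : Set D.PiC) →
      (ES.evalHom j').range.map δ.H.subtype = MulAut.conj n • (ES.evalHom j).range.map δ.H.subtype → j = j') :
    ES.LabelRigid := by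
  intro j j' hjj'
  obtain ⟨f, hfj, hfj'⟩ := hjj'
  obtain ⟨φ, rfl⟩ := OuterHom.ofHom_surjective f
  obtain ⟨n, hn, hφ⟩ := ES.map_range_eq_conj_of_mem_thetaClass hfj φ rfl
  obtain ⟨n', hn', hφ'⟩ := ES.map_range_eq_conj_of_mem_thetaClass hfj' φ rfl
  refine h j j' (n'⁻¹ * n) (Subgroup.mul_mem _ (Subgroup.inv_mem _ hn') hn) ?_
  rw [OuterHom.conj_mul_smul, ← hφ, hφ', OuterHom.conj_inv_mul_smul]

/-- Elements of `Im_j` are determined by their image in `G_v̲`: `y = s_j(aug y)`. ([IUTchI] Ex 4.4 (i) p.106) [claim: Mochizuki2012, status: disputed] -/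
theorem eq_sect_of_mem_map_range {j : FlAbs l} {y : D.PiC} (hy : y ∈ (ES.evalHom j).range.map δ.H.subtype) :
    y = ES.sect j ⟨D.augGF y, ES.aug_mem y (ES.map_range_evalHom_le j hy)⟩ := by
  obtain ⟨x, hx⟩ := ES.mem_map_range_evalHom_iff.mp hy
  subst hx
  congr 1
  apply Subtype.ext
  exact (ES.aug_sect j _).symm

/-- `aug` is INJECTIVE on `Im_j` (a section image meets `Ker(aug)` trivially). ([IUTchI] Ex 4.4 (i) p.106) [claim: Mochizuki2012, status: disputed] -/
theorem eq_of_mem_map_range_of_aug_eq {j : FlAbs l} {y y' : D.PiC} (hy : y ∈ (ES.evalHom j).range.map δ.H.subtype)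
    (hy' : y' ∈ (ES.evalHom j).range.map δ.H.subtype) (h : D.augGF y = D.augGF y') : y = y' := by
  rw [ES.eq_sect_of_mem_map_range hy, ES.eq_sect_of_mem_map_range hy']
  congr 1
  exact Subtype.ext h

/-- **Converse direction**: if `Im_{j′} = n · Im_j · n⁻¹` for some `n ∈ N(Π_v̲)`, then `φ^Θ_{v̲_{j′}}` IS the two-sided composite `c_n ≫ φ^Θ_{v̲_j} ≫ c_{n⁻¹}`
ON THE NOSE (as homomorphisms `Π_v̲ → Π_v̲`): both are sections-after-`aug` with values in `Im_{j′}`, on which `aug` is injective.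
([IUTchI] Ex 4.4 (ii) p.107) [claim: Mochizuki2012, status: disputed] -/
theorem evalHom_eq_conj_of_range_eq_conj {j j' : FlAbs l} {n : D.PiC}
    (h₁ : ∀ x ∈ δ.H, n⁻¹ * x * n ∈ δ.H) (h₂ : ∀ x ∈ δ.H, n⁻¹⁻¹ * x * n⁻¹ ∈ δ.H)
    (h : (ES.evalHom j').range.map δ.H.subtype = MulAut.conj n • (ES.evalHom j).range.map δ.H.subtype) :
    ES.evalHom j' = (OuterHom.conjHom n⁻¹ h₂).comp ((ES.evalHom j).comp (OuterHom.conjHom n h₁)) := by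
  ext x
  -- both values lie in `Im_{j′}` …
  have hz : ((ES.evalHom j (OuterHom.conjHom n h₁ x) : ↥δ.H) : D.PiC) ∈ (ES.evalHom j).range.map δ.H.subtype :=
    OuterHom.mem_map_range_iff.mpr ⟨_, rfl⟩
  have hy₁ : ((ES.evalHom j' x : ↥δ.H) : D.PiC) ∈ (ES.evalHom j').range.map δ.H.subtype :=
    OuterHom.mem_map_range_iff.mpr ⟨_, rfl⟩
  have hy₂ : (((OuterHom.conjHom n⁻¹ h₂).comp ((ES.evalHom j).comp (OuterHom.conjHom n h₁)) x : ↥δ.H) : D.PiC) ∈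
      (ES.evalHom j').range.map δ.H.subtype := by
    rw [h, OuterHom.mem_conj_smul_iff, MonoidHom.comp_apply, MonoidHom.comp_apply, OuterHom.coe_conjHom]
    simpa only [inv_inv, mul_assoc, inv_mul_cancel_left, inv_mul_cancel, mul_one] using hz
  -- … and over the same element of `G_v̲`
  refine congrArg Subtype.val (Subtype.ext (ES.eq_of_mem_map_range_of_aug_eq hy₁ hy₂ ?_))
  rw [coe_evalHom, ES.aug_sect, MonoidHom.comp_apply, MonoidHom.comp_apply, OuterHom.coe_conjHom, map_mul, map_mul, coe_evalHom,
    ES.aug_sect]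
  change D.augGF x = D.augGF n⁻¹⁻¹ * D.augGF ↑((OuterHom.conjHom n h₁) x) * D.augGF n⁻¹
  rw [OuterHom.coe_conjHom, map_mul, map_mul, map_inv, map_inv, inv_inv]
  group

/-- **Converse, class form**: `N(Π_v̲)`-conjugate images put `φ^Θ_{v̲_{j′}}` INSIDE the class of label `j`. ([IUTchI] Ex 4.4 (ii) p.107)
[claim: Mochizuki2012, status: disputed] -/
theorem evalOuter_mem_thetaClass_of_range_eq_conj {j j' : FlAbs l} {n : D.PiC}
    (hn : n ∈ Subgroup.normalizer ((δ.H : Subgroup D.PiC) : Set D.PiC))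
    (h : (ES.evalHom j').range.map δ.H.subtype = MulAut.conj n • (ES.evalHom j).range.map δ.H.subtype) :
    ES.evalOuter j' ∈ ES.thetaClass j := by
  refine ⟨n, n⁻¹, hn, Subgroup.inv_mem _ hn, ?_⟩
  change OuterHom.ofHom (ES.evalHom j') = OuterHom.ofHom _
  exact congrArg OuterHom.ofHom (ES.evalHom_eq_conj_of_range_eq_conj _ _ h)

/-- **CHARACTERISATION — `LabelRigid` ⟺ the `|𝔽_l|` images `Im_j` are pairwise NON-conjugate under `N_{Π_{C_F}}(Π_v̲)`**: exactly what a model of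
`EvalSectionBinder` must supply for the field `label_rigid`, no more and no less. ([IUTchI] Ex 4.4 (iv) p.107) [claim: Mochizuki2012, status: disputed] -/
theorem labelRigid_iff_range_not_conj :
    ES.LabelRigid ↔ ∀ (j j' : FlAbs l) (n : D.PiC), n ∈ Subgroup.normalizer ((δ.H : Subgroup D.PiC) : Set D.PiC) →
      (ES.evalHom j').range.map δ.H.subtype = MulAut.conj n • (ES.evalHom j).range.map δ.H.subtype → j = j' :=
  ⟨fun hLR j j' _ hn h => hLR j j' ⟨ES.evalOuter j', ES.evalOuter_mem_thetaClass_of_range_eq_conj hn h, ES.evalOuter_mem_thetaClass j'⟩,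
    ES.labelRigid_of_range_not_conj⟩

/-- **The printed shape of the criterion**: ANY invariant of subgroups of `Π_{C_F}` under `N(Π_v̲)`-conjugation («group-theoretic»: [EtTh] Cor 2.9,
[SemiAnbd] Thm 6.8 (iii)) that SEPARATES the images `Im_j` yields label rigidity. ([IUTchI] Ex 4.4 (iv) p.107) [claim: Mochizuki2012, status: disputed] -/
theorem labelRigid_of_invariant {ι : Sort*} (I : Subgroup D.PiC → ι)
    (hI : ∀ (S : Subgroup D.PiC) (n : D.PiC), n ∈ Subgroup.normalizer ((δ.H : Subgroup D.PiC) : Set D.PiC) → I (MulAut.conj n • S) = I S)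
    (hsep : Function.Injective fun j : FlAbs l => I ((ES.evalHom j).range.map δ.H.subtype)) : ES.LabelRigid :=
  ES.labelRigid_of_range_not_conj fun j j' n hn h => hsep (by simp only [h, hI _ n hn])

/-- **Necessary side**: two evaluation sections that are conjugate by an element of `Π_v̲` ITSELF have the SAME outer class `φ^Θ`.
([IUTchI] Ex 4.4 (ii) p.107) [claim: Mochizuki2012, status: disputed] -/
theorem evalOuter_eq_of_sect_conj {j j' : FlAbs l} (c : ↥δ.H)
    (hc : ∀ g : ↥Gv, (ES.sect j' g : D.PiC) = (c : D.PiC) * ES.sect j g * (c : D.PiC)⁻¹) : ES.evalOuter j = ES.evalOuter j' := by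
  show OuterHom.ofHom _ = OuterHom.ofHom _
  rw [OuterHom.ofHom_eq_ofHom_iff]
  refine ⟨c, fun x => Subtype.ext ?_⟩
  rw [coe_evalHom, Subgroup.coe_mul, Subgroup.coe_mul, Subgroup.coe_inv, coe_evalHom, hc]

/-- **Design warning for NV models (row «EVALSECT-NV»)**: if two DISTINCT labels are carried by `Π_v̲`-conjugate sections, `LabelRigid` is FALSE — e.g. in a
semidirect model the torsion-translates `s_m = c_m ∘ s_0` with `m ∈ Π_v̲` cannot serve as sections of distinct labels. ([IUTchI] Ex 4.4 (iv) p.107)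
[claim: Mochizuki2012, status: disputed] -/
theorem not_labelRigid_of_sect_conj {j j' : FlAbs l} (hjj' : j ≠ j') (c : ↥δ.H)
    (hc : ∀ g : ↥Gv, (ES.sect j' g : D.PiC) = (c : D.PiC) * ES.sect j g * (c : D.PiC)⁻¹) : ¬ ES.LabelRigid := fun h =>
  hjj' (h j j' ⟨ES.evalOuter j, ES.evalOuter_mem_thetaClass j, by
    rw [ES.evalOuter_eq_of_sect_conj c hc]; exact ES.evalOuter_mem_thetaClass j'⟩)

end EvalSections

end InitialThetaData

end Criterion

end Literature.IUT.HodgeTheaters
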